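import Summits.QuantumFields.BalabanUV.T4Continuum.Support.NE7StraightTowerCurlEnergyD4
import HarnessLib

/-!
# NE7StraightTowerMass — THE LEVEL MASSES OF THE STRAIGHT (DOUBLE-BAR) TOWER, ROOT FORM, ALL LEVELS; IN d = 4 WITH THE CLASS RADII: `√N_{j+1} ≤ 3·L^{−(j+1)}·√N_0`, j-UNIFORM
# (lineage `b2b-balaban-t4-ne7-p1`, gen 117, file F8; ROAD-G117 §4 (S3) — the `ℓ²` level-mass letter that row NE7b's (G3) multiplier programme (SCOPING-G3 §1 (iv)) consumes)

Cell `pub-balaban`, rung (B)+1 sub-cell t4, CRUX PROVER NE7 #1 (OWNER of row NE7), generation 117.  Over F3b∕F4 (✓ `NE7StraightTowerCurlEnergy.sqrt_mass_step`: one step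
`√N(Q̄_W Y) ≤ (√(L²∕L^d) + mC·x)·√N(Y)`) and ✓ `step_small`, by induction peeling the bottom step:
* `towerM d L ν j x` — the recursion `towerM 0 x = √(L²∕L^d) + mC·x`, `towerM (j+1) x = towerM j (prop1Radius x)·(√(L²∕L^d) + mC·x)` (= `Π_{m≤j}(√(L²∕L^d) + mC·x_m)`);
* **`sqrt_mass_QbarIter_le`** — `√(Σ_{z∈periodBox N} Σ_κ nhsNormSq (QbarIter L (j+1) W Y z κ)) ≤ towerM d L ν j x·√(Σ_{b∈periodBox (tower L N (j+1))} Σ_κ nhsNormSq (Y b κ))` (tower class);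
* `towerM_le_prod` (against a radii majorant) and, in `d = 4` with ✓ `levelSmall_of_class_radius`, **`towerM_class_le`**: `towerM 4 L ν j (ε·L^{−2(j+1)}) ≤ 3·(L⁻¹)^{j+1}` under F5's third
  smallness line `8·L·mC·ε·L^{−2} ≤ 1`; headline **`sqrt_mass_QbarIter_le_class_d4`**: `√N_{j+1} ≤ 3·(L⁻¹)^{j+1}·√N_0` — the HS mass of the straight k-fold average of a class configuration
  contracts like `L^{−(j+1)}` on roots (`L^{−2(j+1)}` on masses) up to the factor `3`, UNIFORMLY in `j` and `N`.
HONEST FRAMING: lattice kinematics; the FRAME part `gaugeDir (framePotW)` of `dirIter` does NOT contract (✓ `NE7DirIterL1Letter`); nothing of Bałaban's asserted ((120) p. 35 context only);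
NOT (G3), NOT (G′), NOT NE7 as a spine node; spine 0∕9; finite T⁴ rung (B)+1 — NOT infinite volume, NOT mass gap, NOT BetaPertH, NOT Clay.
-/

set_option autoImplicit false

open scoped BigOperators Matrix.Norms.L2Operator
open NormedSpace Finset

namespace Summit.QuantumFields.BalabanUV.T4Continuum.NE7StraightTowerMass

open Literature.MathematicalPhysics.QuantumFieldTheory.Balaban1983to89
open B7Prop1Explicit B7Prop2Explicit MatrixLog UnitaryModel
open T4AveragingDeficitWall (IsUnitaryCfg SmallField)
open T4AveragingDeficitWallBoundary (IsPeriodicCfg periodBox)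
open AveragingDeficitPeriodicCounting (IsPeriodicDir)
open AveragingDeficitChartCalculus (cavg)
open AveragingDeficitTwoLevelPrep (twoLevelSmall prop1Radius)
open AveragingDeficitMultiLevelPrep (cavgIter tower LevelSmall radIter natCast_tower_succ tower_ne_zero prop1Radius_nonneg)
open AveragingDeficitFermat (isPeriodicCfg_cavg)
open MatrixNorms (nhsNormSq nhsNormSq_nonneg)
open NE3TangentCovariantStructure (Qbar Qbar_add_period)
open NE3TangentCovariantTower (QbarIter QbarIter_succ QbarIter_one step_small)
open NE7RadIterUniform (radD levelSmall_of_class_radius)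
open NE7StraightTowerCurlEnergy (mC mC_nonneg sqrt_mass_step)
open NE7StraightTowerCurlEnergyD4 (prod_add_le_pow_mul_exp)

noncomputable section

variable {d : ℕ} {n : Type*} [Fintype n] [DecidableEq n]

/-! ## §1 The recursion and the tower -/

/-- THE MASS AMPLIFICATION of the straight tower: `towerM 0 x = √(L²∕L^d) + mC·x`, `towerM (j+1) x = towerM j (prop1Radius x)·(√(L²∕L^d) + mC·x)`. [folklore] -/
def towerM (d L : ℕ) (ν : ℝ) : ℕ → ℝ → ℝ
  | 0, x => Real.sqrt ((L : ℝ) ^ 2 / (L : ℝ) ^ d) + mC d L ν * x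
  | j + 1, x => towerM d L ν j (prop1Radius d L x) * (Real.sqrt ((L : ℝ) ^ 2 / (L : ℝ) ^ d) + mC d L ν * x)

omit [Fintype n] [DecidableEq n] in
/-- `0 ≤ towerM d L ν j x` for `x ≥ 0`. [folklore] -/
theorem towerM_nonneg (d L : ℕ) {ν : ℝ} : ∀ (j : ℕ) {x : ℝ}, 0 ≤ x → 0 ≤ towerM d L ν j x
  | 0, x, hx => by unfold towerM; have := mC_nonneg d L (ν := ν); positivity
  | j + 1, x, hx => by
      unfold towerM
      have h1 := towerM_nonneg d L (ν := ν) j (prop1Radius_nonneg (d := d) (L := L) hx)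
      have h3 := mC_nonneg d L (ν := ν)
      positivity

/-- **THE STRAIGHT TOWER'S HS MASS, ALL LEVELS, ROOT FORM** (tower class: `W` unitary `(tower L N (j+1))`-periodic, `0 ≤ x`, `LevelSmall d L j x`, `SmallField W x`; `Y` `(tower L N (j+1))`-periodic):
`√(Σ_{z∈periodBox N} Σ_κ nhsNormSq (QbarIter L (j+1) W Y z κ)) ≤ towerM d L (card n) j x·√(Σ_{b∈periodBox (tower L N (j+1))} Σ_κ nhsNormSq (Y b κ))`. [cite: Balaban1985Averaging, (120) p.35] -/
theorem sqrt_mass_QbarIter_le [Nonempty n] {L N : ℕ} [NeZero L] (hL : 1 ≤ L) (hN : 1 ≤ N) :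
    ∀ (j : ℕ) {W : Site d → Fin d → (Matrix n n ℂ)ˣ} {x : ℝ}, IsUnitaryCfg W → IsPeriodicCfg W ((tower L N (j + 1) : ℕ) : ℤ) → 0 ≤ x →
    LevelSmall d L j x → SmallField W x →
    ∀ {Y : Site d → Fin d → Matrix n n ℂ}, IsPeriodicDir Y ((tower L N (j + 1) : ℕ) : ℤ) →
      Real.sqrt (∑ z ∈ periodBox N, ∑ κ : Fin d, nhsNormSq (QbarIter L (j + 1) W Y z κ))
        ≤ towerM d L (Fintype.card n) j x * Real.sqrt (∑ b ∈ periodBox (tower L N (j + 1)), ∑ κ : Fin d, nhsNormSq (Y b κ)) := by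
  intro j
  induction j with
  | zero =>
      intro W x hWu hWP hx hsm hWx Y hYP
      obtain ⟨h512, -, -, -⟩ := step_small hL hWu hx hsm.two hWx
      have hYP' : IsPeriodicDir Y ((L : ℤ) * N) := by
        have e : ((tower L N (0 + 1) : ℕ) : ℤ) = (L : ℤ) * N := by rw [natCast_tower_succ]; rfl
        rw [← e]; exact hYP
      have h := sqrt_mass_step hL hN hWu hx h512 hWx hYP'
      rw [zero_add, QbarIter_one]
      unfold towerM
      exact h
  | succ j ih =>
      intro W x hWu hWP hx hsm hWx Y hYP
      obtain ⟨h512, hU', hx', hS'⟩ := step_small hL hWu hx hsm.1 hWx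
      have hWP1 : IsPeriodicCfg W ((L : ℤ) * ((tower L N (j + 1) : ℕ) : ℤ)) := by rw [← natCast_tower_succ]; exact hWP
      have hYP1 : IsPeriodicDir Y ((L : ℤ) * ((tower L N (j + 1) : ℕ) : ℤ)) := by rw [← natCast_tower_succ]; exact hYP
      have hWP' : IsPeriodicCfg (cavg L W) ((tower L N (j + 1) : ℕ) : ℤ) := isPeriodicCfg_cavg L _ hWP1
      have hYP' : IsPeriodicDir (Qbar L W Y) ((tower L N (j + 1) : ℕ) : ℤ) := fun z i κ => Qbar_add_period L hWP1 hYP1 z i κ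
      have hT1 : 1 ≤ tower L N (j + 1) := Nat.one_le_iff_ne_zero.mpr (by
        haveI : NeZero N := ⟨by omega⟩
        exact tower_ne_zero L N (j + 1))
      have hih := ih hU' hWP' hx' hsm.2 hS' hYP'
      have hM := sqrt_mass_step hL hT1 hWu hx h512 hWx hYP1
      have eT : L * tower L N (j + 1) = tower L N (j + 1 + 1) := rfl
      rw [eT] at hM
      rw [QbarIter_succ]
      refine hih.trans ?_
      have hB0 : 0 ≤ towerM d L (Fintype.card n : ℝ) j (prop1Radius d L x) := towerM_nonneg d L j hx'
      calc towerM d L (Fintype.card n) j (prop1Radius d L x) * Real.sqrt (∑ b ∈ periodBox (tower L N (j + 1)), ∑ κ : Fin d, nhsNormSq (Qbar L W Y b κ))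
          ≤ towerM d L (Fintype.card n) j (prop1Radius d L x)
              * ((Real.sqrt ((L : ℝ) ^ 2 / (L : ℝ) ^ d) + mC d L (Fintype.card n) * x) * Real.sqrt (∑ b ∈ periodBox (tower L N (j + 1 + 1)), ∑ κ : Fin d, nhsNormSq (Y b κ))) :=
            mul_le_mul_of_nonneg_left hM hB0
        _ = towerM d L (Fintype.card n) (j + 1) x * Real.sqrt (∑ b ∈ periodBox (tower L N (j + 1 + 1)), ∑ κ : Fin d, nhsNormSq (Y b κ)) := by
            rw [towerM]; ring

/-! ## §2 The product form and the d = 4 class evaluation -/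

omit [Fintype n] [DecidableEq n] in
/-- **PRODUCT MAJORANT**: if `radIter m x ≤ g m` for `m ≤ j` (`x, g ≥ 0`), then `towerM d L ν j x ≤ Π_{l≤j}(√(L²∕L^d) + mC·g l)`. [folklore] -/
theorem towerM_le_prod (d L : ℕ) {ν : ℝ} :
    ∀ (j : ℕ) {x : ℝ} (g : ℕ → ℝ), 0 ≤ x → (∀ m, 0 ≤ g m) → (∀ m ≤ j, radIter d L m x ≤ g m) →
      towerM d L ν j x ≤ ∏ l ∈ Finset.range (j + 1), (Real.sqrt ((L : ℝ) ^ 2 / (L : ℝ) ^ d) + mC d L ν * g l)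
  | 0, x, g, hx, hg, hrad => by
      have h0 := hrad 0 le_rfl
      simp only [radIter] at h0
      unfold towerM
      rw [Finset.prod_range_one]
      have := mC_nonneg d L (ν := ν)
      nlinarith
  | j + 1, x, g, hx, hg, hrad => by
      have hmC := mC_nonneg d L (ν := ν)
      have hρN0 : 0 ≤ Real.sqrt ((L : ℝ) ^ 2 / (L : ℝ) ^ d) := Real.sqrt_nonneg _
      have hx1 : 0 ≤ prop1Radius d L x := prop1Radius_nonneg hx
      have hrad1 : ∀ m ≤ j, radIter d L m (prop1Radius d L x) ≤ g (m + 1) := fun m hm => by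
        have h := hrad (m + 1) (by omega)
        simpa [radIter] using h
      have ih := towerM_le_prod d L (ν := ν) j (fun m => g (m + 1)) hx1 (fun m => hg (m + 1)) hrad1
      have h0 : x ≤ g 0 := by have h := hrad 0 (by omega); simpa [radIter] using h
      have hfac0 : 0 ≤ Real.sqrt ((L : ℝ) ^ 2 / (L : ℝ) ^ d) + mC d L ν * x := by positivity
      have hfac : Real.sqrt ((L : ℝ) ^ 2 / (L : ℝ) ^ d) + mC d L ν * x ≤ Real.sqrt ((L : ℝ) ^ 2 / (L : ℝ) ^ d) + mC d L ν * g 0 := by nlinarith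
      have hP0 : 0 ≤ ∏ l ∈ Finset.range (j + 1), (Real.sqrt ((L : ℝ) ^ 2 / (L : ℝ) ^ d) + mC d L ν * g (l + 1)) :=
        Finset.prod_nonneg fun l _ => by have := hg (l + 1); positivity
      show towerM d L ν j (prop1Radius d L x) * (Real.sqrt ((L : ℝ) ^ 2 / (L : ℝ) ^ d) + mC d L ν * x) ≤ _
      rw [Finset.prod_range_succ', mul_comm]
      calc (Real.sqrt ((L : ℝ) ^ 2 / (L : ℝ) ^ d) + mC d L ν * x) * towerM d L ν j (prop1Radius d L x)
          ≤ (Real.sqrt ((L : ℝ) ^ 2 / (L : ℝ) ^ d) + mC d L ν * g 0) * ∏ l ∈ Finset.range (j + 1), (Real.sqrt ((L : ℝ) ^ 2 / (L : ℝ) ^ d) + mC d L ν * g (l + 1)) :=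
            mul_le_mul hfac ih (towerM_nonneg d L j hx1) (by have := hg 0; positivity)
        _ = (∏ l ∈ Finset.range (j + 1), (Real.sqrt ((L : ℝ) ^ 2 / (L : ℝ) ^ d) + mC d L ν * g (l + 1))) * (Real.sqrt ((L : ℝ) ^ 2 / (L : ℝ) ^ d) + mC d L ν * g 0) := by ring

omit [Fintype n] [DecidableEq n] in
/-- **THE CLASS EVALUATION IN d = 4**: for `L ≥ 2`, `0 ≤ ε` with `4ε·radD 4 L·L^{−4} ≤ 1`, `twoLevelSmall 4 L·2ε·L^{−2} ≤ 1`, `8·L·mC 4 L ν·ε·L^{−2} ≤ 1`: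
`towerM 4 L ν j (ε·(L²)⁻¹^{j+1}) ≤ 3·(L⁻¹)^{j+1}` for EVERY `j`. [folklore] -/
theorem towerM_class_le {L : ℕ} (hL : 2 ≤ L) {ν ε : ℝ} (hε : 0 ≤ ε)
    (hεD : 4 * ε * radD 4 L * (((L : ℝ) ^ 2)⁻¹) ^ 2 ≤ 1) (hεT : twoLevelSmall 4 L * (2 * ε * ((L : ℝ) ^ 2)⁻¹) ≤ 1)
    (hεM : 8 * (L : ℝ) * mC 4 L ν * ε * ((L : ℝ) ^ 2)⁻¹ ≤ 1) (j : ℕ) :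
    towerM 4 L ν j (ε * (((L : ℝ) ^ 2)⁻¹) ^ (j + 1)) ≤ 3 * ((L : ℝ)⁻¹) ^ (j + 1) := by
  have hLr : (2 : ℝ) ≤ L := by exact_mod_cast hL
  have hL0 : (0 : ℝ) < L := by linarith
  have hLne : (L : ℝ) ≠ 0 := hL0.ne'
  set q : ℝ := ((L : ℝ) ^ 2)⁻¹ with hq
  have hq0 : 0 ≤ q := by positivity
  have hmC := mC_nonneg 4 L (ν := ν)
  have hρN : Real.sqrt ((L : ℝ) ^ 2 / (L : ℝ) ^ 4) = (L : ℝ)⁻¹ := by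
    rw [show (L : ℝ) ^ 2 / (L : ℝ) ^ 4 = ((L : ℝ)⁻¹) ^ 2 by field_simp, Real.sqrt_sq (by positivity)]
  obtain ⟨-, hrad⟩ := levelSmall_of_class_radius (d := 4) hL hε hεD hεT j
  set g : ℕ → ℝ := fun m => 2 * ε * q ^ (j + 1 - m) with hg
  have hg0 : ∀ m, 0 ≤ g m := fun m => by positivity
  have hradg : ∀ m ≤ j, radIter 4 L m (ε * q ^ (j + 1)) ≤ g m := fun m hm => hrad m (by omega)
  have hprod := towerM_le_prod 4 L (ν := ν) j g (by positivity) hg0 hradg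
  rw [hρN] at hprod
  refine hprod.trans ?_
  -- `Π_{l≤j}(L⁻¹ + mC·g l) ≤ L^{-(j+1)}·exp((mC/L⁻¹)·Σ g) ≤ 3·L^{-(j+1)}`
  refine (prod_add_le_pow_mul_exp (by positivity) hmC g hg0 (j + 1)).trans ?_
  have hgsum : ∑ l ∈ Finset.range (j + 1), g l ≤ 2 * ε * (2 * q) := by
    have hq4 : q ≤ 1 / 4 := by
      rw [hq]; have : (4 : ℝ) ≤ (L : ℝ) ^ 2 := by nlinarith
      calc ((L : ℝ) ^ 2)⁻¹ ≤ (4 : ℝ)⁻¹ := by exact inv_anti₀ (by norm_num) this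
        _ = 1 / 4 := by norm_num
    have hre : ∑ l ∈ Finset.range (j + 1), q ^ (j + 1 - l) = ∑ k ∈ Finset.range (j + 1), q ^ (k + 1) := by
      rw [← Finset.sum_range_reflect]
      refine Finset.sum_congr rfl fun k hk => ?_
      have := Finset.mem_range.mp hk; congr 1; omega
    have hgeom := NE7RadIterUniform.geom_sum_le_two hq0 (by linarith) (j + 2)
    rw [Finset.sum_range_succ'] at hgeom
    simp only [pow_zero] at hgeom
    have h1 : ∑ k ∈ Finset.range (j + 1), q ^ (k + 1) = q * ∑ k ∈ Finset.range (j + 1), q ^ k := by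
      rw [Finset.mul_sum]; exact Finset.sum_congr rfl fun k _ => by ring
    have hgeom' := NE7RadIterUniform.geom_sum_le_two hq0 (by linarith) (j + 1)
    simp only [hg]
    rw [← Finset.mul_sum, hre, h1]
    nlinarith [mul_nonneg hε hq0]
  have hU : mC 4 L ν / (L : ℝ)⁻¹ * ∑ l ∈ Finset.range (j + 1), g l ≤ 1 := by
    have hLmC : 0 ≤ mC 4 L ν / (L : ℝ)⁻¹ := by positivity
    calc mC 4 L ν / (L : ℝ)⁻¹ * ∑ l ∈ Finset.range (j + 1), g l ≤ mC 4 L ν / (L : ℝ)⁻¹ * (2 * ε * (2 * q)) := mul_le_mul_of_nonneg_left hgsum hLmC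
      _ = 8 * (L : ℝ) * mC 4 L ν * ε * q / 2 := by rw [div_inv_eq_mul]; ring
      _ ≤ 1 / 2 := by rw [hq]; linarith
      _ ≤ 1 := by norm_num
  calc ((L : ℝ)⁻¹) ^ (j + 1) * Real.exp (mC 4 L ν / (L : ℝ)⁻¹ * ∑ l ∈ Finset.range (j + 1), g l)
      ≤ ((L : ℝ)⁻¹) ^ (j + 1) * Real.exp 1 := mul_le_mul_of_nonneg_left (Real.exp_le_exp.mpr hU) (by positivity)
    _ ≤ ((L : ℝ)⁻¹) ^ (j + 1) * 3 := mul_le_mul_of_nonneg_left Real.exp_one_lt_three.le (by positivity)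
    _ = 3 * ((L : ℝ)⁻¹) ^ (j + 1) := by ring

/-- **HEADLINE (d = 4)**: under the hypotheses of `towerM_class_le`, for every unitary `(tower L N (j+1))`-periodic `U` with `SmallField U (ε·L^{−2(j+1)})` and every `(tower L N (j+1))`-periodic `Y`:
`√(Σ_{z∈periodBox N} Σ_κ nhsNormSq (QbarIter L (j+1) U Y z κ)) ≤ 3·(L⁻¹)^{j+1}·√(Σ_{b∈periodBox (tower L N (j+1))} Σ_κ nhsNormSq (Y b κ))` — the straight k-fold average of a class
configuration contracts the HS mass root like `L^{−(j+1)}` up to the factor `3`, UNIFORMLY in `j` and `N`. [cite: Balaban1985Averaging, (120) p.35] -/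
theorem sqrt_mass_QbarIter_le_class_d4 [Nonempty n] {L N : ℕ} [NeZero L] (hL : 2 ≤ L) (hN : 1 ≤ N) {ε : ℝ} (hε : 0 ≤ ε)
    (hεD : 4 * ε * radD 4 L * (((L : ℝ) ^ 2)⁻¹) ^ 2 ≤ 1) (hεT : twoLevelSmall 4 L * (2 * ε * ((L : ℝ) ^ 2)⁻¹) ≤ 1)
    (hεM : 8 * (L : ℝ) * mC 4 L (Fintype.card n) * ε * ((L : ℝ) ^ 2)⁻¹ ≤ 1) (j : ℕ)
    {U : Site 4 → Fin 4 → (Matrix n n ℂ)ˣ} (hU : IsUnitaryCfg U) (hUP : IsPeriodicCfg U ((tower L N (j + 1) : ℕ) : ℤ))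
    (hUx : SmallField U (ε * (((L : ℝ) ^ 2)⁻¹) ^ (j + 1)))
    {Y : Site 4 → Fin 4 → Matrix n n ℂ} (hYP : IsPeriodicDir Y ((tower L N (j + 1) : ℕ) : ℤ)) :
    Real.sqrt (∑ z ∈ periodBox N, ∑ κ : Fin 4, nhsNormSq (QbarIter L (j + 1) U Y z κ))
      ≤ 3 * ((L : ℝ)⁻¹) ^ (j + 1) * Real.sqrt (∑ b ∈ periodBox (tower L N (j + 1)), ∑ κ : Fin 4, nhsNormSq (Y b κ)) := by
  have hL1 : 1 ≤ L := by omega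
  have hx0 : 0 ≤ ε * (((L : ℝ) ^ 2)⁻¹) ^ (j + 1) := by positivity
  obtain ⟨hsm, -⟩ := levelSmall_of_class_radius (d := 4) hL hε hεD hεT j
  have h := sqrt_mass_QbarIter_le (d := 4) hL1 hN j hU hUP hx0 hsm hUx hYP
  exact h.trans (mul_le_mul_of_nonneg_right (towerM_class_le hL hε hεD hεT hεM j) (Real.sqrt_nonneg _))

end

end Summit.QuantumFields.BalabanUV.T4Continuum.NE7StraightTowerMass
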